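import Literature.MathematicalPhysics.QuantumFieldTheory.Balaban1983to89.B9Thm312WholeStepRegular
import Literature.MathematicalPhysics.QuantumFieldTheory.Balaban1983to89.B9Thm313WholeHolder

/-!
# `Balaban1983to89.B9Thm313WholeGXHRegular` — T. Bałaban, *Propagators for lattice gauge theories in a background field*, Commun. Math. Phys. **99** (1985) 389–434
# [`Balaban1985BackgroundPropagators`], Theorem 3.13 p. 426 with Theorem 3.12 pp. 421–423: THE LETTER `G₁∇*_U` OF THEOREM 3.13's REDUCTION (the field `gXH` of
# `B9Thm313WholeLettersCut.Letters313Zc`: `G₁∇*_U : 𝔠_Y⁽⁰⁾ → 𝔖`) DERIVED OVER A REGULAR STATE CLASS 𝔖 — from the perturbation step `StepS` ON 𝔖, Theorem 3.3's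
# producer `G₀∇*_U` INTO 𝔖, the identities `G₀Δ_a = 1`, `(Δ_a − Δ′_π − Δ⁽²⁾_π)G₁ = 1`, and the ℓ¹-domination of 𝔖; NO step on a raw sup class

[4] = T. Bałaban, *Propagators and renormalization transformations for lattice gauge theories. II*, Commun. Math. Phys. **96** (1984) 223–250 [`Balaban1984PropagatorsII`].
statement-level skeleton of published theorems with citation tags; proofs where landed; nothing here is a claim about the Yang–Mills mass gap.

THE PRINT.  Thm 3.12 pp. 421–423: `G₁ = G₀ + G₀(Δ′_π + Δ⁽²⁾_π)G₁` ((3.128), (3.138)), the series converging *"in all norms (3.42)–(3.47)"* (p. 422) — i.e. over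
functions of Theorem 3.3's type (REGULAR: a G₀-output with its Hölder sizes), never over a bare sup class (p. 423: Δ⁽²⁾_π is applied to the neighbouring G₀'s);
Thm 3.13 p. 426 then reads the entries of G₁, among them `G₁∇*_U` ((3.42)₃-type), out of that state.

WHY THIS FILE (cell `pub-ymgap`, node N06, bundle F7 rows 20–21, seat dag-n06-l g29; programme P-U8S″, director-ym №289 (1): «U8 cured» = NO raw-class step letter
anywhere in the certificate's cone).  LOCATED-U8″ (this seat, 2026-08-29): the certificate of record derives `Letters313Zc.gXH` through
`B9Thm313WholeCutLettersGXHAtPinsP.gXH_bHZKPG_of_pins` (dag-n06-l g24) from a step `G₀(Δ′_π+Δ⁽²⁾_π) : 𝔠⁽¹⁾ → 𝔠⁽¹⁾` and its Hölder probe on the RAW sup class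
(the displayed `hG0P` conjuncts (1)∕(4)) — №289 (1)'s species.  THIS FILE gives the state-sourced replacement: ★★ `gXH_of_stateS` — `G₁∇*_U : 𝔠_Y⁽⁰⁾ → 𝔖` with
the block majorant `A_D·(1 − κ_𝔖θc)⁻¹·e^{−ρd}` from `StepS 𝔬 𝔖 θ δ_K U` (`B9Thm312WholeStepRegular`), the producer `G₀∇*_U : 𝔠_Y^{(0)} → 𝔖` (A_D, δ_P), `Identities 𝔬 U`,
the ℓ¹-domination `𝔖.loc y F ≤ Λ·Σ|F|` (the a-priori majorant, `exists_hasMaj_const_of_dom`) and `κ_𝔖·θ·c < 1` (`hasMaj_right_of_stepS` = [4] (2.66)'s right-entry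
bootstrap); ★ `gXH_of_stateS_le` — the same at any displayed target constant∕rate `B₃ ≥ A_D(1 − κθc)⁻¹`, `δ₃ ≤ ρ` (the shape of `Letters313Zc.gXH` verbatim once `𝔖 := bXH`);
★ `gXH_of_stateS_two` — constant `2A_D` inside the window `κθc ≤ ½`.
At the certificate's pins `𝔖 := bXH x U` (= 𝔖₁ of the row-21 S-leaf `B9Thm313WholeLeafCompletePairMBCZcUS`), the inputs are the `hstate1` conjuncts the knit already holds.
HONEST SCOPE.  Bookkeeping over landed lemmas; every analytic member is a HYPOTHESIS of printed species; nothing of [B9]∕[4] asserted; no pin, no certificate edit;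
COUNT-NEUTRAL; N06 NOT discharged; nothing continuum ∕ OS positivity ∕ mass gap ∕ Clay.  Cell `pub-ymgap` (HUMAN RULING D-0062), Track A node N06 [B9],
seat `pub-ymgap-dag-n06-l` (g29), 2026-08-29.  NEW file; nothing landed is modified.
-/

namespace Literature.MathematicalPhysics.QuantumFieldTheory.Balaban1983to89.B9Thm313WholeGXHRegular

open Literature.MathematicalPhysics.QuantumFieldTheory.Balaban1983to89
open Finset B6RandomWalk B6RandomWalkHom B9Thm34Ext B11SectG B9SectDSup B9Thm312Whole B9Thm312WholeLeaf B9Thm312WholeClasses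
open B9Thm312WholeStepRegular B9Thm313WholeHolder

noncomputable section

variable {g : B9.Geometry} {B : B9.Backgrounds} {X Y Z W : Type}
variable [Fintype X] [Fintype Y] [Fintype Z] [Fintype W] [Fintype g.Site]
variable {R₀ : ℝ} {H₀ : Prop}

/-- ★★ **`G₁∇*_U` INTO A REGULAR STATE CLASS** — the field `Letters313Zc.gXH` derived, not displayed: if 𝔖 carries the perturbation step
`G₀(Δ′_π+Δ⁽²⁾_π) : 𝔖 → 𝔖` (θ·e^{−δ_K d}), Theorem 3.3's producer `G₀∇*_U : 𝔠_Y^{(0)} → 𝔖` (A_D·e^{−δ_P d}), the identities `G₀Δ_a = 1`,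
`(Δ_a − Δ′_π − Δ⁽²⁾_π)G₁ = 1` and an ℓ¹-domination `𝔖.loc y F ≦ Λ·Σ|F|`, and `κ_𝔖·θ·c < 1` (c = the row-sum constant at margin σ), then
`G₁∇*_U : 𝔠_Y⁽⁰⁾ → 𝔖` with `A_D·(1 − κ_𝔖θc)⁻¹·e^{−ρd}` for every `0 ≦ ρ ≦ δ_P`, `ρ + σ ≦ δ_K` — the first resolvent form `G₁∇* = G₀∇* + G₀(Δ′_π+Δ⁽²⁾_π)(G₁∇*)`
bootstrapped from the a-priori constant majorant ([4] (2.66)).  No step on a raw sup class is used.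
[cite: Balaban1985BackgroundPropagators, Thm 3.13 p.426 + Thm 3.12 (3.128)∕(3.138) pp.421–423 + (3.42) p.397; Balaban1984PropagatorsII, (2.66) p.234 + (2.52)–(2.56) pp.232–233] -/
theorem gXH_of_stateS (hG : GeoOK g) {𝔬 : Ops g B X Y Z W} {U : B.Cfg} {𝔖 : BlockNorm (toB6 g R₀ H₀) (X → ℝ)}
    {σ c θ δK AD δP ρ Λ : ℝ} (hrow : RowSum (toB6 g R₀ H₀) σ c) (hθ : 0 ≤ θ) (hAD : 0 ≤ AD) (hρ : 0 ≤ ρ) (hρP : ρ ≤ δP)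
    (hρK : ρ + σ ≤ δK) (hS : StepS 𝔬 𝔖 θ δK U)
    (hPDs : HasMaj (cNormR R₀ H₀ 𝔬.blkY hG.lenle 0) 𝔖 (𝔬.G0 U ∘ₗ 𝔬.Dstar U) (fun a b => AD * Real.exp (-(δP * g.dist a b))))
    (hI : Identities 𝔬 U) (hΛ : 0 ≤ Λ) (hdom : ∀ (y : g.Site) (F : X → ℝ), 𝔖.loc y F ≤ Λ * ∑ x : X, |F x|)
    (hq : 𝔖.κ * θ * c < 1) :
    HasMaj (cNorm R₀ H₀ 𝔬.blkY hG.lenle 0) 𝔖 (𝔬.G1 U ∘ₗ 𝔬.Dstar U)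
      (fun a b => AD * (1 - 𝔖.κ * θ * c)⁻¹ * Real.exp (-(ρ * g.dist a b))) := by
  -- the a-priori constant majorant out of the sharp class 𝔠_Y⁽⁰⁾ (ℓ¹-domination of 𝔖), moved to the 𝔠_Y^{(0)} spelling of the producer
  obtain ⟨M₀, hM₀, hap⟩ := exists_hasMaj_const_of_dom hG 𝔬.blkY 𝔬.blk 0 hΛ hdom (𝔬.G1 U ∘ₗ 𝔬.Dstar U)
  have hap' : HasMaj (cNormR R₀ H₀ 𝔬.blkY hG.lenle 0) 𝔖 (𝔬.G1 U ∘ₗ 𝔬.Dstar U) (fun _ _ => M₀) := by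
    have h := hasMaj_toR_src hG hap
    rwa [Nat.cast_zero, neg_zero] at h
  -- the first resolvent form and the right-entry bootstrap on 𝔖
  have hfix1 := fix_of_inverses hI.invG0' hI.invG1
  have h := hasMaj_right_of_stepS hG hrow hθ hAD hM₀ hρ hρP hρK hS.step1 hPDs hfix1 hap' hq
  -- back to the source spelling 𝔠_Y⁽⁰⁾ of `Letters313Zc.gXH`
  intro y' μ hμ y
  have hb := (hasMaj_of_in_zero h) y' μ hμ y
  have e : (cNorm R₀ H₀ 𝔬.blkY hG.lenle 0).loc y' μ = (BlockNorm.ofBlocks (toB6 g R₀ H₀) 𝔬.blkY).loc y' μ := by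
    simp only [cNorm, weightNorm_loc, wt, pow_zero, inv_one, one_mul]
  rw [e]; exact hb

/-- ★ **THE SAME AT A DISPLAYED TARGET CONSTANT AND RATE** — `Letters313Zc.gXH`'s shape verbatim (constant `B₃`, rate `δ₃`) once `B₃ ≧ A_D(1 − κ_𝔖θc)⁻¹` and
`δ₃ ≦ ρ`: how the knit inhabits the field at `𝔖 := bXH` from the state layer, with NO raw-class step.
[cite: Balaban1985BackgroundPropagators, Thm 3.13 p.426 + Thm 3.12 pp.421–423; Balaban1984PropagatorsII, (2.66) p.234] -/
theorem gXH_of_stateS_le (hG : GeoOK g) {𝔬 : Ops g B X Y Z W} {U : B.Cfg} {𝔖 : BlockNorm (toB6 g R₀ H₀) (X → ℝ)}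
    {σ c θ δK AD δP ρ Λ B₃ δ₃ : ℝ} (hrow : RowSum (toB6 g R₀ H₀) σ c) (hθ : 0 ≤ θ) (hAD : 0 ≤ AD) (hρ : 0 ≤ ρ) (hρP : ρ ≤ δP)
    (hρK : ρ + σ ≤ δK) (hS : StepS 𝔬 𝔖 θ δK U)
    (hPDs : HasMaj (cNormR R₀ H₀ 𝔬.blkY hG.lenle 0) 𝔖 (𝔬.G0 U ∘ₗ 𝔬.Dstar U) (fun a b => AD * Real.exp (-(δP * g.dist a b))))
    (hI : Identities 𝔬 U) (hΛ : 0 ≤ Λ) (hdom : ∀ (y : g.Site) (F : X → ℝ), 𝔖.loc y F ≤ Λ * ∑ x : X, |F x|)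
    (hq : 𝔖.κ * θ * c < 1) (hB₃ : AD * (1 - 𝔖.κ * θ * c)⁻¹ ≤ B₃) (hδ₃ρ : δ₃ ≤ ρ) :
    HasMaj (cNorm R₀ H₀ 𝔬.blkY hG.lenle 0) 𝔖 (𝔬.G1 U ∘ₗ 𝔬.Dstar U) (fun a b => B₃ * Real.exp (-(δ₃ * g.dist a b))) := by
  have h := gXH_of_stateS hG hrow hθ hAD hρ hρP hρK hS hPDs hI hΛ hdom hq
  have hK0 : 0 ≤ AD * (1 - 𝔖.κ * θ * c)⁻¹ := mul_nonneg hAD (inv_nonneg.mpr (by linarith))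
  refine h.mono fun a b => ?_
  have hd : 0 ≤ g.dist a b := hG.dnn a b
  calc AD * (1 - 𝔖.κ * θ * c)⁻¹ * Real.exp (-(ρ * g.dist a b))
      ≤ AD * (1 - 𝔖.κ * θ * c)⁻¹ * Real.exp (-(δ₃ * g.dist a b)) :=
        mul_le_mul_of_nonneg_left (Real.exp_le_exp.mpr (neg_le_neg (mul_le_mul_of_nonneg_right hδ₃ρ hd))) hK0
    _ ≤ B₃ * Real.exp (-(δ₃ * g.dist a b)) := mul_le_mul_of_nonneg_right hB₃ (Real.exp_nonneg _)

/-- ★ **THE SAME INSIDE THE «α₀ SUFFICIENTLY SMALL» WINDOW** (`κ_𝔖·θ·c ≦ ½`, as the S-leaves arrange by their threshold on Mα₀): constant `2A_D`, rate ρ — the form the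
knit feeds to `Letters313Zc.gXH` after one `HasMaj.mono` to its displayed `B₃ ≧ 2A_D`, `δ₃ ≦ ρ`.
[cite: Balaban1985BackgroundPropagators, Thm 3.13 p.426 + Thm 3.12 pp.421–423 («for α₀ sufficiently small»); Balaban1984PropagatorsII, (2.66) p.234] -/
theorem gXH_of_stateS_two (hG : GeoOK g) {𝔬 : Ops g B X Y Z W} {U : B.Cfg} {𝔖 : BlockNorm (toB6 g R₀ H₀) (X → ℝ)}
    {σ c θ δK AD δP ρ Λ : ℝ} (hrow : RowSum (toB6 g R₀ H₀) σ c) (hθ : 0 ≤ θ) (hAD : 0 ≤ AD) (hρ : 0 ≤ ρ) (hρP : ρ ≤ δP)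
    (hρK : ρ + σ ≤ δK) (hS : StepS 𝔬 𝔖 θ δK U)
    (hPDs : HasMaj (cNormR R₀ H₀ 𝔬.blkY hG.lenle 0) 𝔖 (𝔬.G0 U ∘ₗ 𝔬.Dstar U) (fun a b => AD * Real.exp (-(δP * g.dist a b))))
    (hI : Identities 𝔬 U) (hΛ : 0 ≤ Λ) (hdom : ∀ (y : g.Site) (F : X → ℝ), 𝔖.loc y F ≤ Λ * ∑ x : X, |F x|)
    (hq : 𝔖.κ * θ * c ≤ 1 / 2) :
    HasMaj (cNorm R₀ H₀ 𝔬.blkY hG.lenle 0) 𝔖 (𝔬.G1 U ∘ₗ 𝔬.Dstar U) (fun a b => 2 * AD * Real.exp (-(ρ * g.dist a b))) := by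
  have hq1 : 𝔖.κ * θ * c < 1 := by linarith
  have hinv : (1 - 𝔖.κ * θ * c)⁻¹ ≤ 2 := by
    rw [inv_le_comm₀ (by linarith) (by norm_num : (0 : ℝ) < 2)]
    linarith
  have hB : AD * (1 - 𝔖.κ * θ * c)⁻¹ ≤ 2 * AD := by
    calc AD * (1 - 𝔖.κ * θ * c)⁻¹ ≤ AD * 2 := mul_le_mul_of_nonneg_left hinv hAD
      _ = 2 * AD := by ring
  exact gXH_of_stateS_le hG hrow hθ hAD hρ hρP hρK hS hPDs hI hΛ hdom hq1 hB le_rfl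

end

end Literature.MathematicalPhysics.QuantumFieldTheory.Balaban1983to89.B9Thm313WholeGXHRegular
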